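import Mathlib.NumberTheory.NumberField.Units.DirichletTheorem
import Mathlib.Algebra.Group.Subgroup.Finite
import Mathlib.Order.SymmDiff
import HarnessLib

/-!
# BirchSwinnertonDyer — rank ≥ 2 observatory: units modulo squares from an independence certificate

HONEST FRAMING: per-curve certified theorems and census instruments; no claim on BSD in rank ≥ 2.

Fourth generic file of the KERNEL-2DESC instrument (design `b2b-bsdr2-cert-3/KERNEL-2DESC.md`, (M6)
and A4/A5(ii)): the per-field certificate for the unit part of `L(S,2)` is a list of `r + 1`
explicit units (`r` = unit rank) no non-empty sub-product of which is a square; this file turns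
such an INDEPENDENCE certificate into SPANNING modulo squares, by counting:

* `exists_isSquare_mul_prod_of_indep` — abstract: in a commutative group `G` whose elements are
  `ρ(k)·η²` for `k` ranging over a finite type `κ` with `#κ ≤ 2^#ι`, a family `w : ι → G` with no
  non-empty square sub-product spans `G` modulo squares: every `x` is `(∏_{i ∈ T} w i)⁻¹`, i.e.
  `x · ∏_{i ∈ T} w i` is a square, for some `T ⊆ ι` (the map `T ↦ k(∏_T w)` is injective, hence
  bijective);
* `exists_sign_fundSystem_mul_sq` — Dirichlet for an odd-degree number field: every unit is
  `(−1)^s ∏ εᵢ^{eᵢ} · η²` with `s, eᵢ ∈ {0,1}` over Mathlib's fundamental system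
  (`NumberField.Units.exist_unique_eq_mul_prod`, torsion `= ±1` by
  `torsion_eq_one_or_neg_one_of_odd_finrank`);
* `exists_isSquare_unit_mul_prod` — hence in an odd-degree number field, `rank K + 1` units with
  no non-empty square sub-product span `(𝓞 K)ˣ` modulo squares (the hypothesis `hW` of the
  `V`-cover theorem of the descent).

Sorry-free; axioms `propext`, `Classical.choice`, `Quot.sound`. Reference for the number theory:
D. A. Marcus, *Number Fields*, 2nd ed. (2018), Ch. 5 Thm. 38 (Dirichlet); the counting argument is
elementary linear algebra over `𝔽₂` written multiplicatively.
-/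

-- single-conjunct summit: `Summit.BirchSwinnertonDyer.BirchSwinnertonDyer.…` repeats the name by design
set_option linter.dupNamespace false

noncomputable section

open scoped Classical NumberField

namespace Summit.BirchSwinnertonDyer.BirchSwinnertonDyer.Rank2Observatory.TwoDescCubic

/-! ## Abstract counting: independent mod squares + enough of them ⇒ spanning mod squares -/

section Abstract

variable {G : Type*} [CommGroup G] {ι κ : Type*} [Fintype ι] [Fintype κ]

omit [Fintype ι] in
/-- `(∏_T w)(∏_{T'} w) = (∏_{T ∆ T'} w) · (∏_{T ∩ T'} w)²`. [folklore] -/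
theorem prod_mul_prod_eq_symmDiff (w : ι → G) (T T' : Finset ι) :
    (∏ i ∈ T, w i) * (∏ i ∈ T', w i) = (∏ i ∈ symmDiff T T', w i) * (∏ i ∈ T ∩ T', w i) ^ 2 := by
  have hu : T ∪ T' = symmDiff T T' ∪ (T ∩ T') := by
    ext i
    simp only [Finset.mem_union, Finset.mem_symmDiff, Finset.mem_inter]
    tauto
  have hd : Disjoint (symmDiff T T') (T ∩ T') := by
    rw [Finset.disjoint_left]
    intro i hi
    simp only [Finset.mem_symmDiff, Finset.mem_inter] at hi ⊢
    tauto
  rw [← Finset.prod_union_inter, hu, Finset.prod_union hd, sq, mul_assoc]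

/-- **Independent modulo squares and numerous enough ⇒ spanning modulo squares.** `G` a
commutative group every element of which is `ρ k · η²` for `k` in a finite type `κ` with
`#κ ≤ 2^#ι`; `w : ι → G` with no non-empty square sub-product. Then every `x ∈ G` satisfies
`IsSquare (x · ∏_{i ∈ T} w i)` for some `T`. [folklore] -/
theorem exists_isSquare_mul_prod_of_indep (ρ : κ → G) (hρ : ∀ x : G, ∃ k : κ, ∃ η : G, x = ρ k * η ^ 2)
    (hcard : Fintype.card κ ≤ 2 ^ Fintype.card ι) (w : ι → G)
    (hind : ∀ T : Finset ι, IsSquare (∏ i ∈ T, w i) → T = ∅) (x : G) :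
    ∃ T : Finset ι, IsSquare (x * ∏ i ∈ T, w i) := by
  -- the representative map `T ↦ k(∏_T w)`
  choose k η hk using hρ
  let f : Finset ι → κ := fun T => k (∏ i ∈ T, w i)
  have hf : Function.Injective f := by
    intro T T' hTT'
    have h1 := hk (∏ i ∈ T, w i)
    have h2 := hk (∏ i ∈ T', w i)
    have hsq : IsSquare (∏ i ∈ symmDiff T T', w i) := by
      have hprod := prod_mul_prod_eq_symmDiff w T T'
      have hkk : k (∏ i ∈ T, w i) = k (∏ i ∈ T', w i) := hTT'
      have e : (∏ i ∈ symmDiff T T', w i) =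
          (∏ i ∈ T, w i) * (∏ i ∈ T', w i) * ((∏ i ∈ T ∩ T', w i) ^ 2)⁻¹ := by
        rw [hprod, mul_inv_cancel_right]
      -- `(∏_T w)(∏_{T'} w) = (ρ k ρ k)(η_T² η_{T'}²)` with the same `k`
      have e2 : (∏ i ∈ T, w i) * (∏ i ∈ T', w i) =
          (ρ (k (∏ i ∈ T, w i)) * ρ (k (∏ i ∈ T, w i))) *
            (η (∏ i ∈ T, w i) ^ 2 * η (∏ i ∈ T', w i) ^ 2) := by
        conv_lhs => rw [h1, h2, ← hkk]
        exact mul_mul_mul_comm _ _ _ _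
      rw [e, e2]
      exact ((IsSquare.mul_self _).mul ((IsSquare.sq _).mul (IsSquare.sq _))).mul
        (isSquare_inv.mpr (IsSquare.sq _))
    have h0 := hind _ hsq
    exact symmDiff_eq_bot.mp (h0.trans Finset.bot_eq_empty.symm)
  -- injective between types of the same size ⇒ surjective
  have hcard' : Fintype.card (Finset ι) = Fintype.card κ := by
    apply le_antisymm
    · exact Fintype.card_le_of_injective f hf
    · rwa [Fintype.card_finset]
  have hsurj : Function.Surjective f :=
    (Fintype.bijective_iff_injective_and_card f).mpr ⟨hf, hcard'⟩ |>.2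
  obtain ⟨T, hT⟩ := hsurj (k x)
  refine ⟨T, ?_⟩
  have hx := hk x
  have hT' := hk (∏ i ∈ T, w i)
  rw [show k (∏ i ∈ T, w i) = k x from hT] at hT'
  have e2 : x * (∏ i ∈ T, w i) = (ρ (k x) * ρ (k x)) * (η x ^ 2 * η (∏ i ∈ T, w i) ^ 2) := by
    conv_lhs => arg 2; rw [hT']
    conv_lhs => arg 1; rw [hx]
    exact mul_mul_mul_comm _ _ _ _
  rw [e2]
  exact (IsSquare.mul_self _).mul ((IsSquare.sq _).mul (IsSquare.sq _))

end Abstract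

/-! ## Units of an odd-degree number field modulo squares -/

section Units

open NumberField NumberField.Units Module

variable {K : Type*} [Field K] [NumberField K]

/-- The sign-and-exponent representative `(−1)^s ∏ εᵢ^{eᵢ}` (`s, eᵢ ∈ {0,1}`) over Mathlib's
fundamental system of units. [folklore] -/
def signFundRep (k : Fin 2 × (Fin (rank K) → Fin 2)) : (𝓞 K)ˣ :=
  (-1) ^ (k.1 : ℕ) * ∏ i, fundSystem K i ^ ((k.2 i : ℕ))

/-- **Dirichlet, modulo squares, odd degree**: every unit is `(−1)^s ∏ εᵢ^{eᵢ} · η²` with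
`s, eᵢ ∈ {0, 1}`. [cite: Marcus2018, Ch. 5 Thm. 38] -/
theorem exists_sign_fundSystem_mul_sq (hodd : Odd (finrank ℚ K)) (x : (𝓞 K)ˣ) :
    ∃ k : Fin 2 × (Fin (rank K) → Fin 2), ∃ η : (𝓞 K)ˣ, x = signFundRep k * η ^ 2 := by
  obtain ⟨⟨ζ, e⟩, hx, -⟩ := exist_unique_eq_mul_prod K x
  refine ⟨(if ((ζ : (𝓞 K)ˣ) = 1) then 0 else 1, fun i => ⟨(e i % 2).toNat, by omega⟩),
    ∏ i, fundSystem K i ^ (e i / 2), ?_⟩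
  have hsplit : ∀ i, fundSystem K i ^ e i =
      fundSystem K i ^ (((⟨(e i % 2).toNat, by omega⟩ : Fin 2) : ℕ)) *
        (fundSystem K i ^ (e i / 2)) ^ 2 := by
    intro i
    rw [← zpow_natCast, ← zpow_natCast (fundSystem K i ^ (e i / 2)) 2, ← zpow_mul, ← zpow_add]
    congr 1
    push_cast
    rw [Int.toNat_of_nonneg (Int.emod_nonneg _ two_ne_zero)]
    omega
  rw [signFundRep, ← Finset.prod_pow, mul_assoc, ← Finset.prod_mul_distrib]
  simp_rw [← hsplit]
  rcases torsion_eq_one_or_neg_one_of_odd_finrank hodd ζ with hζ | hζ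
  · rw [if_pos hζ]
    simp only [Fin.val_zero, pow_zero, one_mul]
    rw [hζ, one_mul] at hx
    exact hx
  · have hne : (ζ : (𝓞 K)ˣ) ≠ 1 := by
      rw [hζ]
      intro h
      have h' := congrArg (fun u : (𝓞 K)ˣ => (u : 𝓞 K)) h
      simp only [Units.val_neg, Units.val_one] at h'
      norm_num at h'
    rw [if_neg hne]
    simp only [Fin.val_one, pow_one]
    rw [hζ] at hx
    exact hx

/-- **Units modulo squares from an independence certificate** (odd-degree number field): if
`w₀, …, w_r` (`r = rank K`, e.g. `w₀ = −1` and `r` explicit units) have no non-empty square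
sub-product in `(𝓞 K)ˣ`, then every unit `u` has `IsSquare (u · ∏_{i ∈ T} w i)` for some `T` —
the explicit family generates `(𝓞 K)ˣ/(𝓞 K)ˣ²`. [folklore] -/
theorem exists_isSquare_unit_mul_prod (hodd : Odd (finrank ℚ K)) {m : ℕ} (hm : m = rank K + 1)
    (w : Fin m → (𝓞 K)ˣ) (hind : ∀ T : Finset (Fin m), IsSquare (∏ i ∈ T, w i) → T = ∅)
    (u : (𝓞 K)ˣ) : ∃ T : Finset (Fin m), IsSquare (u * ∏ i ∈ T, w i) := by
  refine exists_isSquare_mul_prod_of_indep signFundRep (exists_sign_fundSystem_mul_sq hodd) ?_ w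
    hind u
  simp only [Fintype.card_prod, Fintype.card_fin, Fintype.card_fun, hm, pow_succ']
  exact le_rfl

omit [NumberField K] in
/-- Independence in `(𝓞 K)ˣ` follows from independence of the images in `K` (the form a character
certificate proves: no non-empty sub-product is a square in `K`). [folklore] -/
theorem indep_units_of_indep_coe {m : ℕ} (w : Fin m → (𝓞 K)ˣ)
    (hind : ∀ T : Finset (Fin m), IsSquare (∏ i ∈ T, ((w i : 𝓞 K) : K)) → T = ∅)
    (T : Finset (Fin m)) (hT : IsSquare (∏ i ∈ T, w i)) : T = ∅ := by
  apply hind T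
  obtain ⟨r, hr⟩ := hT
  refine ⟨((r : 𝓞 K) : K), ?_⟩
  have h := congrArg (fun z : (𝓞 K)ˣ => ((z : 𝓞 K) : K)) hr
  simpa only [Units.coe_prod, Units.val_mul, map_prod, map_mul] using h

end Units

end Summit.BirchSwinnertonDyer.BirchSwinnertonDyer.Rank2Observatory.TwoDescCubic

end
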